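import Mathlib
import HarnessLib
import Literature.Probability.MarkovChains.BottleneckRatio
import Literature.Probability.MarkovChains.DistinguishingStatistic
import Literature.Probability.MarkovChains.PeskunOrdering

/-!
# `Q(S,Sᶜ) = Q(Sᶜ,S)`, the test function `f_S`, and the upper bound `Gap_R ≤ 2Φ⋆` of the Jerrum–Sinclair / Lawler–Sokal inequality (Levin–Peres–Wilmer Theorem 13.10, upper bound)

HONEST FRAMING: exact (Metropolis-corrected) sampling algorithms for lattice gauge theory; figures
of merit are autocorrelation/cost numbers at stated couplings and volumes; no continuum-physics claim.

Conventions of `TotalVariation.lean` / `BottleneckRatio.lean` (`edgeMeasure π P A B = Q(A,B)`,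
`bottleneckRatio π P S = Φ(S)`, `bottleneckRatioStar π P = Φ⋆`), `DistinguishingStatistic.lean`
(`lawVariance` = `Var_π`) and `PeskunOrdering.lean` (`piInner π g h = ⟨g,h⟩_π`, `dirichletForm π P u
= 𝓔_P(u) = ½ Σ π(x)P(x,y)(u(x) − u(y))²`, `dirichletForm_eq` = Lemma 13.6, and the RIGHT SPECTRAL
GAP `spectralGapR π P = Gap_R(P) = inf{𝓔_P(f) : Σ π f = 0, ‖f‖²_π = 1}`).  Source: D. A. Levin,
Y. Peres (with E. L. Wilmer), *Markov Chains and Mixing Times*, 2nd ed., AMS 2017 [LevinPeres2017],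
§13.2 and Exercise 7.2.  Everything is PROVED (finite sums; 0 named facts).

* `lawVariance_eq_half_sum` — **Remark 13.9, eq. (13.5)**: `Var_π(f) = ½ Σ_{x,y} [f(x) − f(y)]² π(x)π(y)`
  [cite: LevinPeres2017, §13.2.1 Remark 13.9 eq. (13.5)]; `dirichletForm_smul` (`𝓔(cu) = c²𝓔(u)`);
* `edgeMeasure_compl_comm` — **Exercise 7.2: `Q(S,Sᶜ) = Q(Sᶜ,S)`** for every `S` and every
  row-stochastic `P` with `πP = π` ("easy in the reversible case, but holds generally")
  [cite: LevinPeres2017, Exercise 7.2]; with `edgeMeasure_univ_right/left`,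
  `edgeMeasure_add_compl_right/left`;
* the TEST FUNCTION `bottleneckTestFun π S = f_S` (`−π(Sᶜ)` on `S`, `π(S)` off `S`) of the proof of
  the upper bound in Theorem 13.10 [cite: LevinPeres2017, §13.2.2, proof of the upper bound in
  Thm 13.10]: `sum_mul_bottleneckTestFun` (`E_π(f_S) = 0`), `piInner_bottleneckTestFun`
  (`‖f_S‖²_π = π(S)π(Sᶜ)`), `lawVariance_bottleneckTestFun`, `dirichletForm_bottleneckTestFun`
  (`𝓔(f_S) = Q(S,Sᶜ)`), `dirichletForm_bottleneckTestFun_le` (`𝓔(f_S) ≤ 2Φ(S)·‖f_S‖²_π` for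
  `π(S) ≤ 1/2`);
* **THEOREM 13.10, UPPER BOUND** for the variational gap: `LevinPeres2017_thm_13_10_upper_set` —
  `Gap_R(P) ≤ 2Φ(S)` for every `S` with `0 < π(S) ≤ 1/2` — and `LevinPeres2017_thm_13_10_upper` —
  **`Gap_R(P) ≤ 2Φ⋆`** (when some set has `0 < π(S) ≤ 1/2`) [cite: LevinPeres2017, §13.2.2
  Thm 13.10 eq. (13.6), upper bound].  SCOPE: the book's `γ = 1 − λ₂` for a REVERSIBLE `P`; its
  Lemma 13.7 identifies `γ` with the variational quantity `min{𝓔(f) : f ⊥_π 1, ‖f‖₂ = 1}`, which is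
  exactly the tree's `spectralGapR` (Andrieu–Vihola's `Gap_R`); the printed proof of the upper
  bound ("By Lemmas 13.7 and 13.6, γ = min … (13.7); … γ ≤ 2Q(S,Sᶜ)/(2π(S)π(Sᶜ)) ≤ 2Φ(S)") is
  therefore, after Lemma 13.7, a statement about `Gap_R`, and that statement is what is typed —
  for EVERY row-stochastic `P` with stationary probability vector `π` (reversibility is used in
  the book only inside Lemma 13.7).  Lemma 13.7 itself (`Gap_R = 1 − λ₂`, the finite-dimensional
  spectral theorem in `ℓ²(π)`) and the LOWER bound `Φ⋆²/2 ≤ γ` (Lemma 13.13, §13.2.3) are NOT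
  formalised here.

Context (cell pub-lqcd, venture LatticeQCDFlow): the conductance inequality of Sinclair–Jerrum
(1989) / Lawler–Sokal (1988) is the printed counterpart "NAMED ONLY" in
`Summits/Ventures/LatticeQCDFlow/Scoring/SectorBottleneckFloor.lean` and `[cite: JerrumSinclair1993]`
of `Scaling/BarriersTunnelling.lean`; this file types its easy half.
-/

namespace Literature.Probability.MarkovChains

open Finset Matrix

variable {X : Type*} [Fintype X] [DecidableEq X]

/-! ## Two identities: Remark 13.9 and homogeneity of `𝓔` -/

omit [DecidableEq X] in
/-- **Remark 13.9, eq. (13.5)**: `Var_π(f) = ½ Σ_{x,y} [f(x) − f(y)]² π(x) π(y)` for a probability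
vector `π` ("if `X, Y` are independent with distribution `π`, `Var_π(f) = ½ E(f(X) − f(Y))²`).
[cite: LevinPeres2017, §13.2.1 Remark 13.9 eq. (13.5)] -/
theorem lawVariance_eq_half_sum {π : X → ℝ} (hπ1 : ∑ x, π x = 1) (f : X → ℝ) :
    lawVariance π f = (1 / 2) * ∑ x, ∑ y, (f x - f y) ^ 2 * (π x * π y) := by
  unfold lawVariance lawMean
  -- left side: `Σ π (f − M)² = Σ π f² − 2M Σ π f + M² Σ π`
  have hM2 : ∀ M : ℝ, ∑ x, π x * (f x - M) ^ 2 =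
      ∑ x, π x * f x ^ 2 - 2 * M * ∑ x, π x * f x + M ^ 2 * ∑ x, π x := by
    intro M
    rw [mul_sum, mul_sum, ← sum_sub_distrib, ← sum_add_distrib]
    exact sum_congr rfl fun x _ => by ring
  -- right side: three double sums
  have T1 : ∑ x, ∑ y, (π x * f x ^ 2) * π y = ∑ x, π x * f x ^ 2 :=
    sum_congr rfl fun x _ => by rw [← mul_sum, hπ1, mul_one]
  have T2 : ∑ x, ∑ y, π x * (π y * f y ^ 2) = ∑ y, π y * f y ^ 2 := by
    rw [← Finset.sum_mul_sum, hπ1, one_mul]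
  have T3 : ∑ x, ∑ y, (π x * f x) * (π y * f y) = (∑ x, π x * f x) ^ 2 := by
    rw [sq, Finset.sum_mul_sum]
  have hR : ∑ x, ∑ y, (f x - f y) ^ 2 * (π x * π y) =
      ∑ x, ∑ y, (π x * f x ^ 2) * π y + ∑ x, ∑ y, π x * (π y * f y ^ 2)
        - 2 * ∑ x, ∑ y, (π x * f x) * (π y * f y) := by
    rw [mul_sum, ← sum_add_distrib, ← sum_sub_distrib]
    refine sum_congr rfl fun x _ => ?_
    rw [mul_sum, ← sum_add_distrib, ← sum_sub_distrib]
    exact sum_congr rfl fun y _ => by ring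
  rw [hM2, hR, T1, T2, T3, hπ1]
  ring

omit [DecidableEq X] in
/-- Homogeneity of the Dirichlet form: `𝓔(c·u) = c² 𝓔(u)`. [cite: LevinPeres2017, §13.2.1 (proof of
Lemma 13.7: "`𝓔(f̃) = 𝓔(f)/‖f‖₂²`" for `f̃ = f/‖f‖₂`)] -/
theorem dirichletForm_smul (π : X → ℝ) (P : Matrix X X ℝ) (c : ℝ) (u : X → ℝ) :
    dirichletForm π P (fun x => c * u x) = c ^ 2 * dirichletForm π P u := by
  unfold dirichletForm
  have h : ∀ x y, π x * P x y * (c * u x - c * u y) ^ 2 = c ^ 2 * (π x * P x y * (u x - u y) ^ 2) :=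
    fun x y => by ring
  simp_rw [h, ← mul_sum]
  ring

/-! ## `Q(S,Sᶜ) = Q(Sᶜ,S)` -/

omit [DecidableEq X] in
/-- `Q(S, X) = π(S)` for unit row sums. [cite: LevinPeres2017, §7.2 eq. (7.5) (`Q(A,B)` is the
probability of moving from `A` to `B` in one step from `π`)] -/
theorem edgeMeasure_univ_right {P : X → X → ℝ} (hP : IsRowStochastic P) (π : X → ℝ)
    (S : Finset X) : edgeMeasure π P S univ = ∑ x ∈ S, π x := by
  unfold edgeMeasure
  exact sum_congr rfl fun x _ => by rw [← mul_sum, hP.2 x, mul_one]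

omit [DecidableEq X] in
/-- `Q(X, S) = π(S)` for a stationary `π`. [cite: LevinPeres2017, §7.2 eq. (7.5) with §1.5
eq. (1.22)] -/
theorem edgeMeasure_univ_left {P : X → X → ℝ} {π : X → ℝ} (hπ : IsStationary π P)
    (S : Finset X) : edgeMeasure π P univ S = ∑ x ∈ S, π x := by
  unfold edgeMeasure
  rw [sum_comm]
  exact sum_congr rfl fun y _ => hπ y

/-- `Q(A,B) + Q(A,Bᶜ) = Q(A,X)`. [cite: LevinPeres2017, §7.2 eq. (7.5)] -/
theorem edgeMeasure_add_compl_right (π : X → ℝ) (P : X → X → ℝ) (A B : Finset X) :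
    edgeMeasure π P A B + edgeMeasure π P A Bᶜ = edgeMeasure π P A univ := by
  unfold edgeMeasure
  rw [← sum_add_distrib]
  exact sum_congr rfl fun x _ => sum_add_sum_compl B _

/-- `Q(B,A) + Q(Bᶜ,A) = Q(X,A)`. [cite: LevinPeres2017, §7.2 eq. (7.5)] -/
theorem edgeMeasure_add_compl_left (π : X → ℝ) (P : X → X → ℝ) (A B : Finset X) :
    edgeMeasure π P B A + edgeMeasure π P Bᶜ A = edgeMeasure π P univ A := by
  unfold edgeMeasure
  exact sum_add_sum_compl B _

/-- **Exercise 7.2: `Q(S,Sᶜ) = Q(Sᶜ,S)`** for every `S`, for any row-stochastic `P` with `πP = π`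
("this is easy in the reversible case, but holds generally"): both equal `π(S) − Q(S,S)`.
[cite: LevinPeres2017, Exercise 7.2] -/
theorem edgeMeasure_compl_comm {P : X → X → ℝ} (hP : IsRowStochastic P) {π : X → ℝ}
    (hπ : IsStationary π P) (S : Finset X) : edgeMeasure π P S Sᶜ = edgeMeasure π P Sᶜ S := by
  have h1 := edgeMeasure_add_compl_right π P S S
  have h2 := edgeMeasure_add_compl_left π P S S
  rw [edgeMeasure_univ_right hP] at h1
  rw [edgeMeasure_univ_left hπ] at h2
  linarith

/-! ## The test function `f_S` -/

/-- The test function of the proof of the upper bound in Theorem 13.10: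
`f_S(x) = −π(Sᶜ)` for `x ∈ S`, `f_S(x) = π(S)` for `x ∉ S`.
[cite: LevinPeres2017, §13.2.2, proof of the upper bound in Thm 13.10] -/
noncomputable def bottleneckTestFun (π : X → ℝ) (S : Finset X) : X → ℝ :=
  fun x => if x ∈ S then -(∑ y ∈ Sᶜ, π y) else ∑ y ∈ S, π y

/-- `E_π(f_S) = Σ_x π(x) f_S(x) = 0`. [cite: LevinPeres2017, §13.2.2, proof of the upper bound in
Thm 13.10 ("Since `E_π(f_S) = 0`")] -/
theorem sum_mul_bottleneckTestFun (π : X → ℝ) (S : Finset X) :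
    ∑ x, π x * bottleneckTestFun π S x = 0 := by
  unfold bottleneckTestFun
  rw [← sum_add_sum_compl S]
  have h1 : ∑ x ∈ S, π x * (if x ∈ S then -(∑ y ∈ Sᶜ, π y) else ∑ y ∈ S, π y) =
      ∑ x ∈ S, π x * (-(∑ y ∈ Sᶜ, π y)) :=
    sum_congr rfl fun x hx => by rw [if_pos hx]
  have h2 : ∑ x ∈ Sᶜ, π x * (if x ∈ S then -(∑ y ∈ Sᶜ, π y) else ∑ y ∈ S, π y) =
      ∑ x ∈ Sᶜ, π x * (∑ y ∈ S, π y) :=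
    sum_congr rfl fun x hx => by rw [if_neg (mem_compl.mp hx)]
  rw [h1, h2, ← sum_mul, ← sum_mul]
  ring

/-- `E_π(f_S) = 0` in the `lawMean` vocabulary. [cite: LevinPeres2017, §13.2.2, proof of the upper
bound in Thm 13.10] -/
theorem lawMean_bottleneckTestFun (π : X → ℝ) (S : Finset X) :
    lawMean π (bottleneckTestFun π S) = 0 :=
  sum_mul_bottleneckTestFun π S

/-- `‖f_S‖²_π = ⟨f_S, f_S⟩_π = π(S)π(Sᶜ)` for a probability vector `π`.
[cite: LevinPeres2017, §13.2.2, proof of the upper bound in Thm 13.10 (the denominator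
`π(S)π(Sᶜ)`)] -/
theorem piInner_bottleneckTestFun {π : X → ℝ} (hπ1 : ∑ x, π x = 1) (S : Finset X) :
    piInner π (bottleneckTestFun π S) (bottleneckTestFun π S) = (∑ x ∈ S, π x) * ∑ x ∈ Sᶜ, π x := by
  unfold piInner bottleneckTestFun
  have hS : ∑ x ∈ S, π x + ∑ x ∈ Sᶜ, π x = 1 := by rw [sum_add_sum_compl, hπ1]
  rw [← sum_add_sum_compl S]
  have h1 : ∑ x ∈ S, π x * ((if x ∈ S then -(∑ y ∈ Sᶜ, π y) else ∑ y ∈ S, π y) *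
      (if x ∈ S then -(∑ y ∈ Sᶜ, π y) else ∑ y ∈ S, π y)) =
      ∑ x ∈ S, π x * (∑ y ∈ Sᶜ, π y) ^ 2 :=
    sum_congr rfl fun x hx => by rw [if_pos hx]; ring
  have h2 : ∑ x ∈ Sᶜ, π x * ((if x ∈ S then -(∑ y ∈ Sᶜ, π y) else ∑ y ∈ S, π y) *
      (if x ∈ S then -(∑ y ∈ Sᶜ, π y) else ∑ y ∈ S, π y)) =
      ∑ x ∈ Sᶜ, π x * (∑ y ∈ S, π y) ^ 2 :=
    sum_congr rfl fun x hx => by rw [if_neg (mem_compl.mp hx)]; ring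
  rw [h1, h2, ← sum_mul, ← sum_mul]
  set a := ∑ x ∈ S, π x
  set b := ∑ x ∈ Sᶜ, π x
  calc a * b ^ 2 + b * a ^ 2 = a * b * (a + b) := by ring
    _ = a * b := by rw [hS, mul_one]

/-- `Var_π(f_S) = π(S)π(Sᶜ)` for a probability vector `π`. [cite: LevinPeres2017, §13.2.2, proof of
the upper bound in Thm 13.10] -/
theorem lawVariance_bottleneckTestFun {π : X → ℝ} (hπ1 : ∑ x, π x = 1) (S : Finset X) :
    lawVariance π (bottleneckTestFun π S) = (∑ x ∈ S, π x) * ∑ x ∈ Sᶜ, π x := by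
  rw [← piInner_bottleneckTestFun hπ1 S]
  unfold lawVariance piInner
  rw [lawMean_bottleneckTestFun]
  exact sum_congr rfl fun x _ => by ring

/-- `𝓔(f_S) = Q(S,Sᶜ)`: the square `[f_S(x) − f_S(y)]²` is `1` exactly when one of `x, y` lies in
`S` and the other does not (`π(S) + π(Sᶜ) = 1`), so `𝓔(f_S) = ½(Q(S,Sᶜ) + Q(Sᶜ,S)) = Q(S,Sᶜ)`
by Exercise 7.2. [cite: LevinPeres2017, §13.2.2, proof of the upper bound in Thm 13.10 (the
numerator `2Q(S,Sᶜ)`)] -/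
theorem dirichletForm_bottleneckTestFun {P : X → X → ℝ} (hP : IsRowStochastic P) {π : X → ℝ}
    (hπ : IsStationary π P) (hπ1 : ∑ x, π x = 1) (S : Finset X) :
    dirichletForm π P (bottleneckTestFun π S) = edgeMeasure π P S Sᶜ := by
  have hS : ∑ x ∈ S, π x + ∑ x ∈ Sᶜ, π x = 1 := by rw [sum_add_sum_compl, hπ1]
  -- the squared difference
  have hsq : ∀ x y, (bottleneckTestFun π S x - bottleneckTestFun π S y) ^ 2 =
      if (x ∈ S ↔ y ∈ S) then 0 else 1 := by
    intro x y
    unfold bottleneckTestFun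
    by_cases hx : x ∈ S
    · by_cases hy : y ∈ S
      · rw [if_pos hx, if_pos hy, if_pos (iff_of_true hx hy)]; ring
      · rw [if_pos hx, if_neg hy, if_neg (fun h => hy (h.mp hx)),
          show -(∑ y ∈ Sᶜ, π y) - ∑ y ∈ S, π y = -1 by linarith]
        norm_num
    · by_cases hy : y ∈ S
      · rw [if_neg hx, if_pos hy, if_neg (fun h => hx (h.mpr hy)),
          show ∑ y ∈ S, π y - -(∑ y ∈ Sᶜ, π y) = 1 by linarith]
        norm_num
      · rw [if_neg hx, if_neg hy, if_pos (iff_of_false hx hy)]; ring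
  unfold dirichletForm
  simp_rw [hsq]
  -- split the double sum over `S`/`Sᶜ` in both variables
  have hinner : ∀ x, ∑ y, π x * P x y * (if (x ∈ S ↔ y ∈ S) then (0 : ℝ) else 1) =
      if x ∈ S then ∑ y ∈ Sᶜ, π x * P x y else ∑ y ∈ S, π x * P x y := by
    intro x
    rw [← sum_add_sum_compl S]
    by_cases hx : x ∈ S
    · rw [if_pos hx]
      have h1 : ∑ y ∈ S, π x * P x y * (if (x ∈ S ↔ y ∈ S) then (0 : ℝ) else 1) = 0 :=
        sum_eq_zero fun y hy => by rw [if_pos (iff_of_true hx hy), mul_zero]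
      have h2 : ∑ y ∈ Sᶜ, π x * P x y * (if (x ∈ S ↔ y ∈ S) then (0 : ℝ) else 1) =
          ∑ y ∈ Sᶜ, π x * P x y :=
        sum_congr rfl fun y hy => by
          rw [if_neg (fun h => (mem_compl.mp hy) (h.mp hx)), mul_one]
      rw [h1, h2, zero_add]
    · rw [if_neg hx]
      have h1 : ∑ y ∈ S, π x * P x y * (if (x ∈ S ↔ y ∈ S) then (0 : ℝ) else 1) =
          ∑ y ∈ S, π x * P x y :=
        sum_congr rfl fun y hy => by rw [if_neg (fun h => hx (h.mpr hy)), mul_one]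
      have h2 : ∑ y ∈ Sᶜ, π x * P x y * (if (x ∈ S ↔ y ∈ S) then (0 : ℝ) else 1) = 0 :=
        sum_eq_zero fun y hy => by
          rw [if_pos (iff_of_false hx (mem_compl.mp hy)), mul_zero]
      rw [h1, h2, add_zero]
  simp_rw [hinner]
  rw [← sum_add_sum_compl S]
  have hA : ∑ x ∈ S, (if x ∈ S then ∑ y ∈ Sᶜ, π x * P x y else ∑ y ∈ S, π x * P x y) =
      edgeMeasure π P S Sᶜ := sum_congr rfl fun x hx => by rw [if_pos hx]
  have hB : ∑ x ∈ Sᶜ, (if x ∈ S then ∑ y ∈ Sᶜ, π x * P x y else ∑ y ∈ S, π x * P x y) =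
      edgeMeasure π P Sᶜ S := sum_congr rfl fun x hx => by rw [if_neg (mem_compl.mp hx)]
  rw [hA, hB, ← edgeMeasure_compl_comm hP hπ S]
  ring

/-- The Rayleigh quotient of `f_S`: `𝓔(f_S) ≤ 2Φ(S)·‖f_S‖²_π` for `0 < π(S) ≤ 1/2`, i.e.
`𝓔(f_S)/‖f_S‖²_π = Q(S,Sᶜ)/(π(S)π(Sᶜ)) ≤ 2Q(S,Sᶜ)/π(S) = 2Φ(S)`.
[cite: LevinPeres2017, §13.2.2 Thm 13.10 (proof of the upper bound, last display)] -/
theorem dirichletForm_bottleneckTestFun_le {P : X → X → ℝ} (hP : IsRowStochastic P) {π : X → ℝ}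
    (hπ : IsStationary π P) (hπ0 : ∀ x, 0 ≤ π x) (hπ1 : ∑ x, π x = 1) {S : Finset X}
    (hS0 : 0 < ∑ x ∈ S, π x) (hS : ∑ x ∈ S, π x ≤ 1 / 2) :
    dirichletForm π P (bottleneckTestFun π S) ≤
      2 * bottleneckRatio π P S * piInner π (bottleneckTestFun π S) (bottleneckTestFun π S) := by
  rw [dirichletForm_bottleneckTestFun hP hπ hπ1, piInner_bottleneckTestFun hπ1]
  unfold bottleneckRatio
  have hSc : 1 / 2 ≤ ∑ x ∈ Sᶜ, π x := by
    have := sum_add_sum_compl S π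
    rw [hπ1] at this
    linarith
  have hQ : 0 ≤ edgeMeasure π P S Sᶜ := edgeMeasure_nonneg hπ0 hP.1 S Sᶜ
  have ha : (∑ x ∈ S, π x) ≠ 0 := hS0.ne'
  have key : 2 * (edgeMeasure π P S Sᶜ / ∑ x ∈ S, π x) * ((∑ x ∈ S, π x) * ∑ x ∈ Sᶜ, π x) =
      2 * edgeMeasure π P S Sᶜ * ∑ x ∈ Sᶜ, π x := by
    field_simp
  rw [key]
  nlinarith

/-! ## Theorem 13.10, upper bound, for the variational gap `Gap_R` -/

/-- **Theorem 13.10 (upper bound), per set**: `Gap_R(P) ≤ 2Φ(S)` for every `S` with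
`0 < π(S) ≤ 1/2`, for a row-stochastic `P` with stationary probability vector `π ≥ 0` — the
normalised test function `f_S/‖f_S‖_π` is admissible in the infimum defining `Gap_R` and has
Dirichlet energy `Q(S,Sᶜ)/(π(S)π(Sᶜ)) ≤ 2Φ(S)`.  (`Gap_R = γ = 1 − λ₂` for reversible `P` is
Lemma 13.7, not formalised.) [cite: LevinPeres2017, §13.2.2 Thm 13.10 (proof of the upper bound)] -/
theorem LevinPeres2017_thm_13_10_upper_set {P : X → X → ℝ} (hP : IsRowStochastic P) {π : X → ℝ}
    (hπ : IsStationary π P) (hπ0 : ∀ x, 0 ≤ π x) (hπ1 : ∑ x, π x = 1) {S : Finset X}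
    (hS0 : 0 < ∑ x ∈ S, π x) (hS : ∑ x ∈ S, π x ≤ 1 / 2) :
    spectralGapR π P ≤ 2 * bottleneckRatio π P S := by
  set V : ℝ := (∑ x ∈ S, π x) * ∑ x ∈ Sᶜ, π x with hV
  have hSc : 1 / 2 ≤ ∑ x ∈ Sᶜ, π x := by
    have := sum_add_sum_compl S π
    rw [hπ1] at this
    linarith
  have hVpos : 0 < V := mul_pos hS0 (by linarith)
  set c : ℝ := 1 / Real.sqrt V with hc
  have hc2 : c ^ 2 = 1 / V := by
    rw [hc, div_pow, one_pow, Real.sq_sqrt hVpos.le]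
  set g : X → ℝ := fun x => c * bottleneckTestFun π S x with hg
  -- admissibility of `g = f_S/‖f_S‖_π`
  have hg0 : ∑ x, π x * g x = 0 := by
    simp only [hg]
    have : ∑ x, π x * (c * bottleneckTestFun π S x) = c * ∑ x, π x * bottleneckTestFun π S x := by
      rw [mul_sum]; exact sum_congr rfl fun x _ => by ring
    rw [this, sum_mul_bottleneckTestFun, mul_zero]
  have hg1 : piInner π g g = 1 := by
    have : piInner π g g = c ^ 2 * piInner π (bottleneckTestFun π S) (bottleneckTestFun π S) := by
      unfold piInner
      rw [mul_sum]
      exact sum_congr rfl fun x _ => by simp only [hg]; ring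
    rw [this, piInner_bottleneckTestFun hπ1, ← hV, hc2, one_div, inv_mul_cancel₀ hVpos.ne']
  -- its energy
  have hE : dirichletForm π P g = c ^ 2 * dirichletForm π P (bottleneckTestFun π S) :=
    dirichletForm_smul π P c _
  calc spectralGapR π P ≤ dirichletForm π P g := spectralGapR_le_dirichletForm hπ0 hP.1 hg0 hg1
    _ = c ^ 2 * dirichletForm π P (bottleneckTestFun π S) := hE
    _ ≤ c ^ 2 * (2 * bottleneckRatio π P S *
          piInner π (bottleneckTestFun π S) (bottleneckTestFun π S)) :=
        mul_le_mul_of_nonneg_left (dirichletForm_bottleneckTestFun_le hP hπ hπ0 hπ1 hS0 hS)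
          (sq_nonneg c)
    _ = 2 * bottleneckRatio π P S := by
        rw [piInner_bottleneckTestFun hπ1, ← hV, hc2]
        field_simp

/-- **Theorem 13.10 (Sinclair–Jerrum 1989, Lawler–Sokal 1988), upper bound: `Gap_R(P) ≤ 2Φ⋆`**, for
a row-stochastic `P` with stationary probability vector `π ≥ 0` on a space with at least one set of
mass `0 < π(S) ≤ 1/2` (so that `Φ⋆` is a genuine minimum).  For a reversible `P`, `Gap_R = 1 − λ₂`
(Lemma 13.7, not formalised) and this is the printed `γ ≤ 2Φ⋆`; the lower bound `Φ⋆²/2 ≤ γ` is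
not typed. [cite: LevinPeres2017, §13.2.2 Thm 13.10 eq. (13.6) (upper bound)] -/
theorem LevinPeres2017_thm_13_10_upper {P : X → X → ℝ} (hP : IsRowStochastic P) {π : X → ℝ}
    (hπ : IsStationary π P) (hπ0 : ∀ x, 0 ≤ π x) (hπ1 : ∑ x, π x = 1)
    (hX : ∃ S : Finset X, 0 < ∑ x ∈ S, π x ∧ ∑ x ∈ S, π x ≤ 1 / 2) :
    spectralGapR π P ≤ 2 * bottleneckRatioStar π P := by
  obtain ⟨S, ⟨hS0, hS⟩, hSeq⟩ := exists_bottleneckRatioStar_eq π P hX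
  rw [← hSeq]
  exact LevinPeres2017_thm_13_10_upper_set hP hπ hπ0 hπ1 hS0 hS

end Literature.Probability.MarkovChains
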